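import Summits.ResolutionOfSingularities.ResolutionOfSingularities.Theorems.EquisingularLiftEquisingularLiftNatResidualCut
import HarnessLib

/-!
# `EquisingularLiftNat` (EL♮, stmt-ResolutionOfSingularities-20038) — THE RESIDUAL CUT BY STAGES (reach an isolated stage, then finish),
# with the glue `ReachIsolated → FinishIsolated → EquisingularLiftNat` proved

Route `Theses/EquisingularLift.lean` (rev 4), crux chain w45b [OURS · L1 W4.5(b)], CRUX-STRATEGIST seat res-L1-w45b-strat-1 (gen 6; standing
seat λ2 ALONGSIDE the leads res-L1-w45b-lead-1 / lead-2 and the planner res-L1-w45b-plan-1 of the registered line `sections`, skeleton v6, residual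
stub `stub_elnat_ge_four`). Support file for the crux item (`--supports stmt-ResolutionOfSingularities-20038 --as helper`): it closes nothing, does
not touch the lead's skeleton and registers nothing (a reshape of `stub_elnat_ge_four` along the theorems below is the LEAD's call). Sequel of
`…NatSplit.lean` (p501020, dimension bands) and `…NatResidualCut.lean` (p508745, the cut BY CASES isolated / non-isolated, whose non-isolated half is
summit-strength over `k̄` modulo re-embedding).

THE CUT BY STAGES. The cut by cases asks each half to run a WHOLE chain; here the chain itself is cut at the first stage whose reduced strict
transform has FINITELY MANY non-regular points:
* `HReach q Y (X₁, σ₁, S₁) (P′, σ, S′)` — `(P′, σ, S′)` lies in the closure of the STAGE `(X₁, σ₁, S₁)` under the horizontal E1 steps over `(P, Y, q)`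
  (blow-up in a regular centre, `O`-flat, over non-generic points of `Y`, special points inside the current strict transform — the step relation of
  `HorizAt` / of the registered stubs, byte-for-byte). From the base `(P, 𝟙, Y)` it IS the chain clause of `HorizAt`; continuation from a stage is
  measured against the ORIGINAL `(P, Y)`, so concatenation is two lines of logic (`hReach_trans`) — no generic-fibre bookkeeping (contrast
  `EquisingularLift.Split.Chain.comp` of the 08-17 strata split, which re-bases the chain at the stage).
* `ReachIsolatedAt p k n H ι` (piece A, per hypersurface): some COMPLETE characteristic-0 DVR `O` with `π : O ↠ k` such that for every graded `φ`
  over `π` and `Y = range (ι ≫ Proj.map φ)` some stage `(X₁, σ₁, S₁)` reachable from `(ℙⁿ_O, 𝟙, Y)` has `singSet S₁` FINITE and the ambient has good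
  reduction at each of its points (`GoodSet`, the 08-17 clause `EquisingularLift.Split.GoodSet` VERBATIM: regular, uniformizer a regular parameter).
* `FinishIsolatedAt p k n H ι` (piece B): for EVERY complete characteristic-0 DVR `O`, `π`, `φ`, `Y` and EVERY such stage, some continuation
  `HReach … (X₁, σ₁, S₁) (P′, σ, S′)` has regular reduced `V(closure S′)`.
* `PointDropAt p k n H ι` (piece B in inductive form): from every such stage with `≥ 1` non-regular point, some continuation reaches a stage of the same
  kind with STRICTLY FEWER non-regular points. `finishIsolatedAt_of_pointDropAt` (strong induction on `Set.ncard (singSet S₁)`) and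
  `pointDropAt_of_finishIsolatedAt` (a regular end has no non-regular point): the two forms are EQUIVALENT.
* GLUE (pure logic + `natAt_of_horizAt`, p508745): `horizAt_of_reachIsolatedAt_of_finishIsolatedAt` (per hypersurface, every `n`),
  `equisingularLiftNat_of_stages : (∀ p, ReachIsolated p) → (∀ p, FinishIsolated p) → EquisingularLiftNat` (the crux BY NAME from the two pieces; `p` a parameter as in the skeleton's bands `UpToThree p` …),
  `equisingularLiftNat_of_reach_pointDrop`, and for the registered residual band: `geFourHoriz_of_stages`, `stub_elnat_ge_four_of_stages` (the v6 text
  of `stub_elnat_ge_four`, verbatim, from `GeFourReachIsolated p` and `GeFourFinishIsolated p`), `equisingularLiftNat_of_upToThree_of_stages`.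

PRECEDENT AND DELTA. The seam is the STRATA seam of the crux-strategist of 2026-08-17 on the parent crux `EquisingularLift` (stmt-15660):
`EquisingularLift.Split.LiftableIsolation → IsolatedPointDrop → EquisingularLift` (`Theorems/EquisingularLiftDefs.lean`,
`Theorems/EquisingularLiftEquisingularLiftSplit.lean`, never applied as a route split). New here: (i) the ♮ currency of the crux of record — fixed
ambient `ℙⁿ_O`, every graded `φ` over `π`, `O`-FLAT centres with E1 — so that the pieces compose with the registered skeleton (`stub_elnat_ge_four`) and
are the hypotheses / conclusions of the landed stage engine T-ISO-0-REL (`EquisingularLiftNatRel.pointResolution_from_horizStage`, which continues a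
horizontal E1 stage whose reduced strict transform is point-resolvable downstairs; NOTE it assumes good reduction at ALL special points of the stage,
this file's pieces only at the non-regular points of the strict transform — the weaker clause is what makes piece A a consequence of the crux with
complete `O`: at a regular end `GoodSet` is vacuous); (ii) continuation typed by `HReach` from the stage (no re-basing); (iii) both forms of piece B.

STRENGTH (by hand, OURS, candidates not facts; kernel part = the pure-logic theorems below). Piece A alone gives only «every integral hypersurface of
`ℙⁿ_k̄` is properly birationally dominated by a variety with finitely many non-regular points» (ISO-RED), not resolution; piece B alone contains EL♮
for hypersurfaces with isolated singularities (stage `(ℙⁿ_O, 𝟙, Y)`), i.e. resolution WITH LIFTING of isolated hypersurface singularities of every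
dimension — open for `n ≥ 5`, not known to imply the summit; A ∧ B ⟹ EL♮ ⟹ summit over `k̄`. Neither piece is the crux reworded: A drops the
regular end, B adds the isolated-stage hypothesis. The K5-BMY disprover target (#50 of `L/w45b/CHAIN.md` §5: `n = 5`, `Sing H` a smooth surface
violating BMY) bears on piece A verbatim (reaching a finite non-regular locus forces a useful touch at `η_{Sing H}`, ULT p505870).
-/

set_option linter.dupNamespace false -- mandated namespace `Summit.<Summit>.<Problem>` of this single-conjunct summit

open CategoryTheory CategoryTheory.Limits AlgebraicGeometry TopologicalSpace Topology
open Literature.AlgebraicGeometry.Resolution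
open AlgebraicGeometry.Scheme.IdealSheafData
open Summit.ResolutionOfSingularities.ResolutionOfSingularities.Theses.EquisingularLift.Split
open Summit.ResolutionOfSingularities.ResolutionOfSingularities.Cruxes.EquisingularLiftNat.Sections
open Summit.ResolutionOfSingularities.ResolutionOfSingularities.Theorems.EquisingularLift
open Summit.ResolutionOfSingularities.ResolutionOfSingularities.Theorems.EquisingularLiftNatBands
open Summit.ResolutionOfSingularities.ResolutionOfSingularities.Theorems.EquisingularLiftNatResidualCut

namespace Summit.ResolutionOfSingularities.ResolutionOfSingularities.Theorems.EquisingularLiftNatStageCut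

/-! ## Reachability from a stage under the horizontal E1 steps -/

/-- [OURS · L1 W4.5(b)] **`(P′, σ, S′)` is reachable from the stage `(X₁, σ₁, S₁)`** under the horizontal E1 steps over `(P, Y, q : P → Spec O)`:
the least predicate containing the stage and closed under «blow up `X′` in a regular centre `C`, `O`-flat (`C ↪ X′ → P → Spec O` flat), with
`σ′(C)` off the generic point(s) of `Y` and the special points of `C` inside the current strict transform `Y′`; pass to
`(X″, τ ≫ σ′, closure (τ⁻¹(Y′ ∖ C)))`» — the step relation of `HorizAt` byte-for-byte; from `(P, 𝟙, Y)` it is `HorizAt`'s chain clause. [folklore] -/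
def HReach {O : Type} [CommRing O] [IsLocalRing O] {P : AlgebraicGeometry.Scheme.{0}} (q : P ⟶ AlgebraicGeometry.Spec (.of O)) (Y : Set P)
    (X₁ : AlgebraicGeometry.Scheme.{0}) (σ₁ : X₁ ⟶ P) (S₁ : Set X₁)
    (P' : AlgebraicGeometry.Scheme.{0}) (σ : P' ⟶ P) (S' : Set P') : Prop :=
  ∀ Q : (∀ X' : AlgebraicGeometry.Scheme.{0}, (X' ⟶ P) → Set X' → Prop), Q X₁ σ₁ S₁ →
    (∀ (X' X'' : AlgebraicGeometry.Scheme.{0}) (σ' : X' ⟶ P) (Y' : Set X') (C : X'.IdealSheafData) (τ : X'' ⟶ X'),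
      Q X' σ' Y' → Literature.AlgebraicGeometry.Resolution.IsBlowup τ C → Literature.AlgebraicGeometry.Resolution.Scheme.IsRegular C.subscheme →
      AlgebraicGeometry.Flat (CategoryTheory.CategoryStruct.comp C.subschemeι (CategoryTheory.CategoryStruct.comp σ' q)) →
      σ' '' (C.support : Set X') ⊆ {x | ¬ IsGenericPoint x Y} →
      (C.support : Set X') ∩ (CategoryTheory.CategoryStruct.comp σ' q) ⁻¹' {IsLocalRing.closedPoint O} ⊆ Y' →
      Q X'' (CategoryTheory.CategoryStruct.comp τ σ') (closure (τ ⁻¹' (Y' \ (C.support : Set X'))))) →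
    Q P' σ S'

section HReach

variable {O : Type} [CommRing O] [IsLocalRing O] {P : AlgebraicGeometry.Scheme.{0}} {q : P ⟶ AlgebraicGeometry.Spec (.of O)} {Y : Set P}

/-- Every stage is reachable from itself. [folklore] -/
theorem hReach_refl (X₁ : AlgebraicGeometry.Scheme.{0}) (σ₁ : X₁ ⟶ P) (S₁ : Set X₁) : HReach q Y X₁ σ₁ S₁ X₁ σ₁ S₁ :=
  fun _ h0 _ => h0

/-- **Concatenation is free**: reachable from a reachable stage is reachable (two lines of logic, no generic-fibre bookkeeping). [folklore] -/
theorem hReach_trans {X₀ : AlgebraicGeometry.Scheme.{0}} {σ₀ : X₀ ⟶ P} {S₀ : Set X₀} {X₁ : AlgebraicGeometry.Scheme.{0}} {σ₁ : X₁ ⟶ P} {S₁ : Set X₁}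
    {X₂ : AlgebraicGeometry.Scheme.{0}} {σ₂ : X₂ ⟶ P} {S₂ : Set X₂}
    (h₁ : HReach q Y X₀ σ₀ S₀ X₁ σ₁ S₁) (h₂ : HReach q Y X₁ σ₁ S₁ X₂ σ₂ S₂) : HReach q Y X₀ σ₀ S₀ X₂ σ₂ S₂ :=
  fun Q h0 hs => h₂ Q (h₁ Q h0 hs) hs

/-- One horizontal E1 step from a reachable stage is reachable. [folklore] -/
theorem hReach_step {X₀ : AlgebraicGeometry.Scheme.{0}} {σ₀ : X₀ ⟶ P} {S₀ : Set X₀} {X' X'' : AlgebraicGeometry.Scheme.{0}} {σ' : X' ⟶ P} {Y' : Set X'}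
    (C : X'.IdealSheafData) (τ : X'' ⟶ X') (h : HReach q Y X₀ σ₀ S₀ X' σ' Y')
    (hb : Literature.AlgebraicGeometry.Resolution.IsBlowup τ C) (hr : Literature.AlgebraicGeometry.Resolution.Scheme.IsRegular C.subscheme)
    (hfl : AlgebraicGeometry.Flat (CategoryTheory.CategoryStruct.comp C.subschemeι (CategoryTheory.CategoryStruct.comp σ' q)))
    (hg : σ' '' (C.support : Set X') ⊆ {x | ¬ IsGenericPoint x Y})
    (hE : (C.support : Set X') ∩ (CategoryTheory.CategoryStruct.comp σ' q) ⁻¹' {IsLocalRing.closedPoint O} ⊆ Y') :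
    HReach q Y X₀ σ₀ S₀ X'' (CategoryTheory.CategoryStruct.comp τ σ') (closure (τ ⁻¹' (Y' \ (C.support : Set X')))) :=
  fun Q h0 hs => hs X' X'' σ' Y' C τ (h Q h0 hs) hb hr hfl hg hE

/-- **Induction on reachability**: a property of stages holding at the start and preserved by the steps holds at every reachable stage. [folklore] -/
theorem hReach_induction {X₀ : AlgebraicGeometry.Scheme.{0}} {σ₀ : X₀ ⟶ P} {S₀ : Set X₀} (Q : ∀ X' : AlgebraicGeometry.Scheme.{0}, (X' ⟶ P) → Set X' → Prop)
    (h0 : Q X₀ σ₀ S₀)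
    (hs : ∀ (X' X'' : AlgebraicGeometry.Scheme.{0}) (σ' : X' ⟶ P) (Y' : Set X') (C : X'.IdealSheafData) (τ : X'' ⟶ X'),
      Q X' σ' Y' → Literature.AlgebraicGeometry.Resolution.IsBlowup τ C → Literature.AlgebraicGeometry.Resolution.Scheme.IsRegular C.subscheme →
      AlgebraicGeometry.Flat (CategoryTheory.CategoryStruct.comp C.subschemeι (CategoryTheory.CategoryStruct.comp σ' q)) →
      σ' '' (C.support : Set X') ⊆ {x | ¬ IsGenericPoint x Y} →
      (C.support : Set X') ∩ (CategoryTheory.CategoryStruct.comp σ' q) ⁻¹' {IsLocalRing.closedPoint O} ⊆ Y' →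
      Q X'' (CategoryTheory.CategoryStruct.comp τ σ') (closure (τ ⁻¹' (Y' \ (C.support : Set X')))))
    {X₁ : AlgebraicGeometry.Scheme.{0}} {σ₁ : X₁ ⟶ P} {S₁ : Set X₁} (h : HReach q Y X₀ σ₀ S₀ X₁ σ₁ S₁) : Q X₁ σ₁ S₁ :=
  h Q h0 hs

end HReach

/-! ## The non-regular locus of a reduced strict transform: empty iff regular -/

/-- `V(closure S′)` (reduced) is regular iff `singSet S′ = ∅`. [folklore] -/
theorem isRegular_iff_singSet_eq_empty {P' : AlgebraicGeometry.Scheme.{0}} (S' : Set P') :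
    Literature.AlgebraicGeometry.Resolution.Scheme.IsRegular (AlgebraicGeometry.Scheme.IdealSheafData.vanishingIdeal (⟨closure S', isClosed_closure⟩ : TopologicalSpace.Closeds P')).subscheme ↔ singSet S' = ∅ := by
  constructor
  · intro hreg
    exact Set.eq_empty_of_forall_notMem fun x hx => hx (hreg x)
  · intro he x
    by_contra hx
    have : x ∈ singSet S' := hx
    rw [he] at this
    exact this

/-! ## The pieces, per hypersurface `(p, k, n, H, ι)` -/

/-- [OURS · L1 W4.5(b)] **Piece A — REACH AN ISOLATED STAGE** at the hypersurface `(k, n, H, ι)`: a COMPLETE characteristic-0 DVR `O` with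
`π : O ↠ k` such that for every graded `φ` over `π` and `Y = range (ι ≫ Proj.map φ)` some stage `(X₁, σ₁, S₁)` reachable from `(ℙⁿ_O, 𝟙, Y)` under the
horizontal E1 steps has FINITELY MANY non-regular points on its reduced strict transform `V(closure S₁)`, the ambient `X₁ → Spec O` having good
reduction (`GoodSet`: regular, uniformizer a regular parameter) at each of them. A route-posited OPEN statement (piece A of the strategist's cut by
stages of EL♮; not a published result). [folklore] -/
def ReachIsolatedAt (p : ℕ) (k : Type) [Field k] [CharP k p] [IsAlgClosed k] (n : ℕ) (H : AlgebraicGeometry.Scheme.{0}) (ι : H ⟶ (Literature.AlgebraicGeometry.Motives.projectiveSpace n k).left) : Prop :=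
  ∃ (O : Type) (_ : CommRing O) (_ : IsDomain O) (_ : IsDiscreteValuationRing O) (_ : CharZero O) (_ : IsAdicComplete (IsLocalRing.maximalIdeal O) O) (π : O →+* k), Function.Surjective π ∧ (letI := MvPolynomial.gradedAlgebra (σ := Fin (n + 1)) (R := O); letI := MvPolynomial.gradedAlgebra (σ := Fin (n + 1)) (R := k); ∀ (φ : MvPolynomial.homogeneousSubmodule (Fin (n + 1)) O →+*ᵍ MvPolynomial.homogeneousSubmodule (Fin (n + 1)) k) (hφ' : HomogeneousIdeal.irrelevant (MvPolynomial.homogeneousSubmodule (Fin (n + 1)) k) ≤ (HomogeneousIdeal.irrelevant (MvPolynomial.homogeneousSubmodule (Fin (n + 1)) O)).map φ), (∀ s, φ s = MvPolynomial.map π s) → ∀ Y : Set (AlgebraicGeometry.Proj (MvPolynomial.homogeneousSubmodule (Fin (n + 1)) O)), Y = Set.range (CategoryTheory.CategoryStruct.comp ι (AlgebraicGeometry.Proj.map φ hφ') : H ⟶ (AlgebraicGeometry.Proj (MvPolynomial.homogeneousSubmodule (Fin (n + 1)) O))) → ∃ (X₁ : AlgebraicGeometry.Scheme.{0}) (σ₁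 : X₁ ⟶ (AlgebraicGeometry.Proj (MvPolynomial.homogeneousSubmodule (Fin (n + 1)) O))) (S₁ : Set X₁), HReach (CategoryTheory.CategoryStruct.comp (AlgebraicGeometry.Proj.toSpecZero (MvPolynomial.homogeneousSubmodule (Fin (n + 1)) O)) (AlgebraicGeometry.Spec.map (CommRingCat.ofHom (algebraMap O (MvPolynomial.homogeneousSubmodule (Fin (n + 1)) O 0))))) Y (AlgebraicGeometry.Proj (MvPolynomial.homogeneousSubmodule (Fin (n + 1)) O)) (CategoryTheory.CategoryStruct.id _) Y X₁ σ₁ S₁ ∧ (singSet S₁).Finite ∧ GoodSet (CategoryTheory.CategoryStruct.comp σ₁ (CategoryTheory.CategoryStruct.comp (AlgebraicGeometry.Proj.toSpecZero (MvPolynomial.homogeneousSubmodule (Fin (n + 1)) O)) (AlgebraicGeometry.Spec.map (CommRingCat.ofHom (algebraMap O (MvPolynomial.homogeneousSubmodule (Fin (n + 1)) O 0)))))) S₁)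

/-- [OURS · L1 W4.5(b)] **Piece B — FINISH FROM AN ISOLATED STAGE** at `(k, n, H, ι)`: for EVERY complete characteristic-0 DVR `O` with `π : O ↠ k`,
every graded `φ` over `π`, `Y = range (ι ≫ Proj.map φ)` and every stage `(X₁, σ₁, S₁)` reachable from `(ℙⁿ_O, 𝟙, Y)` with finitely many non-regular
points on `V(closure S₁)` and good reduction of the ambient at each of them, some CONTINUATION `(P′, σ, S′)` reachable from the stage has regular
reduced `V(closure S′)`. A route-posited OPEN statement (piece B; contains EL♮ for hypersurfaces with isolated singularities, stage `(ℙⁿ_O, 𝟙, Y)`).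
[folklore] -/
def FinishIsolatedAt (p : ℕ) (k : Type) [Field k] [CharP k p] [IsAlgClosed k] (n : ℕ) (H : AlgebraicGeometry.Scheme.{0}) (ι : H ⟶ (Literature.AlgebraicGeometry.Motives.projectiveSpace n k).left) : Prop :=
  ∀ (O : Type) [CommRing O] [IsDomain O] [IsDiscreteValuationRing O] [CharZero O] [IsAdicComplete (IsLocalRing.maximalIdeal O) O] (π : O →+* k), Function.Surjective π → (letI := MvPolynomial.gradedAlgebra (σ := Fin (n + 1)) (R := O); letI := MvPolynomial.gradedAlgebra (σ := Fin (n + 1)) (R := k); ∀ (φ : MvPolynomial.homogeneousSubmodule (Fin (n + 1)) O →+*ᵍ MvPolynomial.homogeneousSubmodule (Fin (n + 1)) k) (hφ' : HomogeneousIdeal.irrelevant (MvPolynomial.homogeneousSubmodule (Fin (n + 1)) k) ≤ (HomogeneousIdeal.irrelevant (MvPolynomial.homogeneousSubmodule (Fin (n + 1)) O)).map φ), (∀ s, φ s = MvPolynomial.map π s) → ∀ Y : Set (AlgebraicGeometry.Proj (MvPolynomial.homogeneousSubmodule (Fin (n + 1)) O)), Y = Set.range (CategoryTheory.CategoryStruct.comp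 ι (AlgebraicGeometry.Proj.map φ hφ') : H ⟶ (AlgebraicGeometry.Proj (MvPolynomial.homogeneousSubmodule (Fin (n + 1)) O))) → ∀ (X₁ : AlgebraicGeometry.Scheme.{0}) (σ₁ : X₁ ⟶ (AlgebraicGeometry.Proj (MvPolynomial.homogeneousSubmodule (Fin (n + 1)) O))) (S₁ : Set X₁), HReach (CategoryTheory.CategoryStruct.comp (AlgebraicGeometry.Proj.toSpecZero (MvPolynomial.homogeneousSubmodule (Fin (n + 1)) O)) (AlgebraicGeometry.Spec.map (CommRingCat.ofHom (algebraMap O (MvPolynomial.homogeneousSubmodule (Fin (n + 1)) O 0))))) Y (AlgebraicGeometry.Proj (MvPolynomial.homogeneousSubmodule (Fin (n + 1)) O)) (CategoryTheory.CategoryStruct.id _) Y X₁ σ₁ S₁ → (singSet S₁).Finite → GoodSet (CategoryTheory.CategoryStruct.comp σ₁ (CategoryTheory.CategoryStruct.comp (AlgebraicGeometry.Proj.toSpecZero (MvPolynomial.homogeneousSubmodule (Fin (n + 1)) O)) (AlgebraicGeometry.Spec.map (CommRingCat.ofHom (algebraMap O (MvPolynomial.homogeneousSubmodule (Fin (n +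 1)) O 0)))))) S₁ → ∃ (P' : AlgebraicGeometry.Scheme.{0}) (σ : P' ⟶ (AlgebraicGeometry.Proj (MvPolynomial.homogeneousSubmodule (Fin (n + 1)) O))) (S' : Set P'), HReach (CategoryTheory.CategoryStruct.comp (AlgebraicGeometry.Proj.toSpecZero (MvPolynomial.homogeneousSubmodule (Fin (n + 1)) O)) (AlgebraicGeometry.Spec.map (CommRingCat.ofHom (algebraMap O (MvPolynomial.homogeneousSubmodule (Fin (n + 1)) O 0))))) Y X₁ σ₁ S₁ P' σ S' ∧ Literature.AlgebraicGeometry.Resolution.Scheme.IsRegular (AlgebraicGeometry.Scheme.IdealSheafData.vanishingIdeal (⟨closure S', isClosed_closure⟩ : TopologicalSpace.Closeds P')).subscheme)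

/-- [OURS · L1 W4.5(b)] **Piece B in inductive form — ISOLATED POINT DROP** at `(k, n, H, ι)`: from every stage as in `FinishIsolatedAt` with AT
LEAST ONE non-regular point, some continuation reaches a stage of the same kind (finitely many non-regular points, good reduction at each) with
STRICTLY FEWER non-regular points. Equivalent to `FinishIsolatedAt` (`finishIsolatedAt_of_pointDropAt`, `pointDropAt_of_finishIsolatedAt`). [folklore] -/
def PointDropAt (p : ℕ) (k : Type) [Field k] [CharP k p] [IsAlgClosed k] (n : ℕ) (H : AlgebraicGeometry.Scheme.{0}) (ι : H ⟶ (Literature.AlgebraicGeometry.Motives.projectiveSpace n k).left) : Prop :=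
  ∀ (O : Type) [CommRing O] [IsDomain O] [IsDiscreteValuationRing O] [CharZero O] [IsAdicComplete (IsLocalRing.maximalIdeal O) O] (π : O →+* k), Function.Surjective π → (letI := MvPolynomial.gradedAlgebra (σ := Fin (n + 1)) (R := O); letI := MvPolynomial.gradedAlgebra (σ := Fin (n + 1)) (R := k); ∀ (φ : MvPolynomial.homogeneousSubmodule (Fin (n + 1)) O →+*ᵍ MvPolynomial.homogeneousSubmodule (Fin (n + 1)) k) (hφ' : HomogeneousIdeal.irrelevant (MvPolynomial.homogeneousSubmodule (Fin (n + 1)) k) ≤ (HomogeneousIdeal.irrelevant (MvPolynomial.homogeneousSubmodule (Fin (n + 1)) O)).map φ), (∀ s, φ s = MvPolynomial.map π s) → ∀ Y : Set (AlgebraicGeometry.Proj (MvPolynomial.homogeneousSubmodule (Fin (n + 1)) O)), Y = Set.range (CategoryTheory.CategoryStruct.comp ι (AlgebraicGeometry.Proj.map φ hφ') : H ⟶ (AlgebraicGeometry.Proj (MvPolynomial.homogeneousSubmodule (Fin (n + 1)) O))) → ∀ (X₁ : AlgebraicGeometry.Scheme.{0}) (σ₁ : X₁ ⟶ (AlgebraicGeometry.Proj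 (MvPolynomial.homogeneousSubmodule (Fin (n + 1)) O))) (S₁ : Set X₁), HReach (CategoryTheory.CategoryStruct.comp (AlgebraicGeometry.Proj.toSpecZero (MvPolynomial.homogeneousSubmodule (Fin (n + 1)) O)) (AlgebraicGeometry.Spec.map (CommRingCat.ofHom (algebraMap O (MvPolynomial.homogeneousSubmodule (Fin (n + 1)) O 0))))) Y (AlgebraicGeometry.Proj (MvPolynomial.homogeneousSubmodule (Fin (n + 1)) O)) (CategoryTheory.CategoryStruct.id _) Y X₁ σ₁ S₁ → (singSet S₁).Finite → GoodSet (CategoryTheory.CategoryStruct.comp σ₁ (CategoryTheory.CategoryStruct.comp (AlgebraicGeometry.Proj.toSpecZero (MvPolynomial.homogeneousSubmodule (Fin (n + 1)) O)) (AlgebraicGeometry.Spec.map (CommRingCat.ofHom (algebraMap O (MvPolynomial.homogeneousSubmodule (Fin (n + 1)) O 0)))))) S₁ → (singSet S₁).Nonempty → ∃ (X₂ : AlgebraicGeometry.Scheme.{0}) (σ₂ : X₂ ⟶ (AlgebraicGeometry.Proj (MvPolynomial.homogeneousSubmodule (Fin (n + 1)) O))) (S₂ : Set X₂), HReach (CategoryTheory.CategoryStruct.comp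 (AlgebraicGeometry.Proj.toSpecZero (MvPolynomial.homogeneousSubmodule (Fin (n + 1)) O)) (AlgebraicGeometry.Spec.map (CommRingCat.ofHom (algebraMap O (MvPolynomial.homogeneousSubmodule (Fin (n + 1)) O 0))))) Y X₁ σ₁ S₁ X₂ σ₂ S₂ ∧ (singSet S₂).Finite ∧ GoodSet (CategoryTheory.CategoryStruct.comp σ₂ (CategoryTheory.CategoryStruct.comp (AlgebraicGeometry.Proj.toSpecZero (MvPolynomial.homogeneousSubmodule (Fin (n + 1)) O)) (AlgebraicGeometry.Spec.map (CommRingCat.ofHom (algebraMap O (MvPolynomial.homogeneousSubmodule (Fin (n + 1)) O 0)))))) S₂ ∧ (singSet S₂).ncard < (singSet S₁).ncard)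

/-! ## The two forms of piece B are equivalent -/

/-- **POINT DROP ⟹ FINISH** — strong induction on the number of non-regular points of the reduced strict transform; concatenation by
`hReach_trans`; a stage with no non-regular point is its own regular end. [folklore] -/
theorem finishIsolatedAt_of_pointDropAt (p : ℕ) (k : Type) [Field k] [CharP k p] [IsAlgClosed k] (n : ℕ) (H : AlgebraicGeometry.Scheme.{0}) (ι : H ⟶ (Literature.AlgebraicGeometry.Motives.projectiveSpace n k).left)
    (h : PointDropAt p k n H ι) : FinishIsolatedAt p k n H ι := by
  intro O _ _ _ _ _ π hπ
  letI := MvPolynomial.gradedAlgebra (σ := Fin (n + 1)) (R := O)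
  letI := MvPolynomial.gradedAlgebra (σ := Fin (n + 1)) (R := k)
  intro φ hφ' hφ Y hY
  have key : ∀ (m : ℕ) (X₁ : AlgebraicGeometry.Scheme.{0}) (σ₁ : X₁ ⟶ (AlgebraicGeometry.Proj (MvPolynomial.homogeneousSubmodule (Fin (n + 1)) O))) (S₁ : Set X₁),
      HReach (CategoryTheory.CategoryStruct.comp (AlgebraicGeometry.Proj.toSpecZero (MvPolynomial.homogeneousSubmodule (Fin (n + 1)) O)) (AlgebraicGeometry.Spec.map (CommRingCat.ofHom (algebraMap O (MvPolynomial.homogeneousSubmodule (Fin (n + 1)) O 0))))) Y (AlgebraicGeometry.Proj (MvPolynomial.homogeneousSubmodule (Fin (n + 1)) O)) (CategoryTheory.CategoryStruct.id _) Y X₁ σ₁ S₁ → (singSet S₁).Finite → GoodSet (CategoryTheory.CategoryStruct.comp σ₁ (CategoryTheory.CategoryStruct.comp (AlgebraicGeometry.Proj.toSpecZero (MvPolynomial.homogeneousSubmodule (Fin (n + 1)) O)) (AlgebraicGeometry.Spec.map (CommRingCat.ofHom (algebraMap O (MvPolynomial.homogeneousSubmodule (Fin (n + 1)) O 0))))))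 S₁ → (singSet S₁).ncard = m →
      ∃ (P' : AlgebraicGeometry.Scheme.{0}) (σ : P' ⟶ (AlgebraicGeometry.Proj (MvPolynomial.homogeneousSubmodule (Fin (n + 1)) O))) (S' : Set P'), HReach (CategoryTheory.CategoryStruct.comp (AlgebraicGeometry.Proj.toSpecZero (MvPolynomial.homogeneousSubmodule (Fin (n + 1)) O)) (AlgebraicGeometry.Spec.map (CommRingCat.ofHom (algebraMap O (MvPolynomial.homogeneousSubmodule (Fin (n + 1)) O 0))))) Y X₁ σ₁ S₁ P' σ S' ∧ Literature.AlgebraicGeometry.Resolution.Scheme.IsRegular (AlgebraicGeometry.Scheme.IdealSheafData.vanishingIdeal (⟨closure S', isClosed_closure⟩ : TopologicalSpace.Closeds P')).subscheme := by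
    intro m
    induction m using Nat.strong_induction_on with
    | _ m ih =>
      intro X₁ σ₁ S₁ hR hfin hgood hm
      by_cases hne : (singSet S₁).Nonempty
      · obtain ⟨X₂, σ₂, S₂, hR₂, hfin₂, hgood₂, hlt⟩ := h O π hπ φ hφ' hφ Y hY X₁ σ₁ S₁ hR hfin hgood hne
        obtain ⟨P', σ, S', hR', hreg⟩ := ih _ (lt_of_lt_of_eq hlt hm) X₂ σ₂ S₂ (hReach_trans hR hR₂) hfin₂ hgood₂ rfl
        exact ⟨P', σ, S', hReach_trans hR₂ hR', hreg⟩
      · refine ⟨X₁, σ₁, S₁, hReach_refl X₁ σ₁ S₁, ?_⟩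
        rw [isRegular_iff_singSet_eq_empty]
        exact Set.not_nonempty_iff_eq_empty.1 hne
  intro X₁ σ₁ S₁ hR hfin hgood
  exact key _ X₁ σ₁ S₁ hR hfin hgood rfl

/-- **FINISH ⟹ POINT DROP** — a regular end has no non-regular point (`isRegular_iff_singSet_eq_empty`), and a finite nonempty set has
positive `ncard`. [folklore] -/
theorem pointDropAt_of_finishIsolatedAt (p : ℕ) (k : Type) [Field k] [CharP k p] [IsAlgClosed k] (n : ℕ) (H : AlgebraicGeometry.Scheme.{0}) (ι : H ⟶ (Literature.AlgebraicGeometry.Motives.projectiveSpace n k).left)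
    (h : FinishIsolatedAt p k n H ι) : PointDropAt p k n H ι := by
  intro O _ _ _ _ _ π hπ
  letI := MvPolynomial.gradedAlgebra (σ := Fin (n + 1)) (R := O)
  letI := MvPolynomial.gradedAlgebra (σ := Fin (n + 1)) (R := k)
  intro φ hφ' hφ Y hY X₁ σ₁ S₁ hR hfin hgood hne
  obtain ⟨P', σ, S', hR', hreg⟩ := h O π hπ φ hφ' hφ Y hY X₁ σ₁ S₁ hR hfin hgood
  have he : singSet S' = ∅ := (isRegular_iff_singSet_eq_empty S').1 hreg
  refine ⟨P', σ, S', hR', ?_, ?_, ?_⟩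
  · rw [he]; exact Set.finite_empty
  · intro x hx; exact absurd (hreg x) hx
  · rw [he, Set.ncard_empty]; exact (Set.ncard_pos hfin).2 hne

/-! ## Glue, per hypersurface and every `n`: A ∧ B ⟹ `HorizAt` ⟹ the EL♮ conclusion -/

/-- **A ∧ B ⟹ `HorizAt`** (per hypersurface, every `n`): take A's complete `O` and its isolated stage, continue with B, concatenate with
`hReach_trans`; `HorizAt`'s chain clause is `HReach` from `(ℙⁿ_O, 𝟙, Y)` by `rfl`. [folklore] -/
theorem horizAt_of_reachIsolatedAt_of_finishIsolatedAt (p : ℕ) (k : Type) [Field k] [CharP k p] [IsAlgClosed k] (n : ℕ) (H : AlgebraicGeometry.Scheme.{0}) (ι : H ⟶ (Literature.AlgebraicGeometry.Motives.projectiveSpace n k).left)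
    (hA : ReachIsolatedAt p k n H ι) (hB : FinishIsolatedAt p k n H ι) : HorizAt p k n H ι := by
  obtain ⟨O, i1, i2, i3, i4, i5, π, hπ, hA'⟩ := hA
  letI := MvPolynomial.gradedAlgebra (σ := Fin (n + 1)) (R := O)
  letI := MvPolynomial.gradedAlgebra (σ := Fin (n + 1)) (R := k)
  refine ⟨O, i1, i2, i3, i4, π, hπ, ?_⟩
  intro φ hφ' hφ Y hY
  obtain ⟨X₁, σ₁, S₁, hR, hfin, hgood⟩ := hA' φ hφ' hφ Y hY
  obtain ⟨P', σ, S', hR', hreg⟩ := hB O π hπ φ hφ' hφ Y hY X₁ σ₁ S₁ hR hfin hgood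
  exact ⟨P', σ, S', hReach_trans hR hR', hreg⟩

/-- The same with B in inductive form. [folklore] -/
theorem horizAt_of_reachIsolatedAt_of_pointDropAt (p : ℕ) (k : Type) [Field k] [CharP k p] [IsAlgClosed k] (n : ℕ) (H : AlgebraicGeometry.Scheme.{0}) (ι : H ⟶ (Literature.AlgebraicGeometry.Motives.projectiveSpace n k).left)
    (hA : ReachIsolatedAt p k n H ι) (hB : PointDropAt p k n H ι) : HorizAt p k n H ι :=
  horizAt_of_reachIsolatedAt_of_finishIsolatedAt p k n H ι hA (finishIsolatedAt_of_pointDropAt p k n H ι hB)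

/-- **A ∧ B ⟹ the EL♮ conclusion block** at an integral hypersurface (every `n`; `natAt_of_horizAt`, p508745). [folklore] -/
theorem elNatAt_of_reachIsolatedAt_of_finishIsolatedAt (p : ℕ) (k : Type) [Field k] [CharP k p] [IsAlgClosed k] (n : ℕ) (H : AlgebraicGeometry.Scheme.{0}) (ι : H ⟶ (Literature.AlgebraicGeometry.Motives.projectiveSpace n k).left)
    (hι : AlgebraicGeometry.IsClosedImmersion ι) (hH : AlgebraicGeometry.IsIntegral H)
    (hA : ReachIsolatedAt p k n H ι) (hB : FinishIsolatedAt p k n H ι) :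
    Summit.ResolutionOfSingularities.ResolutionOfSingularities.Theorems.EquisingularLift.ELNatAt p k n H ι :=
  elNatAt_of_horizAt p k n H ι hι hH (horizAt_of_reachIsolatedAt_of_finishIsolatedAt p k n H ι hA hB)

/-- **A ∧ B resolve the hypersurface** (every `n`; `hasResolution_of_horizAt`). [folklore] -/
theorem hasResolution_of_reachIsolatedAt_of_finishIsolatedAt (p : ℕ) (k : Type) [Field k] [CharP k p] [IsAlgClosed k] (n : ℕ) (H : AlgebraicGeometry.Scheme.{0}) (ι : H ⟶ (Literature.AlgebraicGeometry.Motives.projectiveSpace n k).left)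
    (hι : AlgebraicGeometry.IsClosedImmersion ι) (hH : AlgebraicGeometry.IsIntegral H)
    (hA : ReachIsolatedAt p k n H ι) (hB : FinishIsolatedAt p k n H ι) :
    Literature.AlgebraicGeometry.Resolution.Scheme.HasResolution H :=
  hasResolution_of_horizAt p k n H ι hι hH (horizAt_of_reachIsolatedAt_of_finishIsolatedAt p k n H ι hA hB)

/-! ## The ∀-quantified pieces and the crux BY NAME -/

/-- [OURS · L1 W4.5(b)] **Piece A, all primes and hypersurfaces** (the outer binders of `EquisingularLiftNat`, then `ReachIsolatedAt`). [folklore] -/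
def ReachIsolated (p : ℕ) : Prop :=
  p.Prime → ∀ (k : Type) [Field k] [CharP k p] [IsAlgClosed k] (n : ℕ) (H : AlgebraicGeometry.Scheme.{0}) (ι : H ⟶ (Literature.AlgebraicGeometry.Motives.projectiveSpace n k).left), AlgebraicGeometry.IsClosedImmersion ι → AlgebraicGeometry.IsIntegral H → (∀ y : (Literature.AlgebraicGeometry.Motives.projectiveSpace n k).left, ∃ U : (Literature.AlgebraicGeometry.Motives.projectiveSpace n k).left.affineOpens, y ∈ (U : (Literature.AlgebraicGeometry.Motives.projectiveSpace n k).left.Opens) ∧ (ι.ker.ideal U).IsPrincipal) → ReachIsolatedAt p k n H ι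

/-- [OURS · L1 W4.5(b)] **Piece B, all primes and hypersurfaces** (the outer binders of `EquisingularLiftNat`, then `FinishIsolatedAt`). [folklore] -/
def FinishIsolated (p : ℕ) : Prop :=
  p.Prime → ∀ (k : Type) [Field k] [CharP k p] [IsAlgClosed k] (n : ℕ) (H : AlgebraicGeometry.Scheme.{0}) (ι : H ⟶ (Literature.AlgebraicGeometry.Motives.projectiveSpace n k).left), AlgebraicGeometry.IsClosedImmersion ι → AlgebraicGeometry.IsIntegral H → (∀ y : (Literature.AlgebraicGeometry.Motives.projectiveSpace n k).left, ∃ U : (Literature.AlgebraicGeometry.Motives.projectiveSpace n k).left.affineOpens, y ∈ (U : (Literature.AlgebraicGeometry.Motives.projectiveSpace n k).left.Opens) ∧ (ι.ker.ideal U).IsPrincipal) → FinishIsolatedAt p k n H ι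

/-- [OURS · L1 W4.5(b)] **Piece B in inductive form, all primes and hypersurfaces.** [folklore] -/
def PointDrop (p : ℕ) : Prop :=
  p.Prime → ∀ (k : Type) [Field k] [CharP k p] [IsAlgClosed k] (n : ℕ) (H : AlgebraicGeometry.Scheme.{0}) (ι : H ⟶ (Literature.AlgebraicGeometry.Motives.projectiveSpace n k).left), AlgebraicGeometry.IsClosedImmersion ι → AlgebraicGeometry.IsIntegral H → (∀ y : (Literature.AlgebraicGeometry.Motives.projectiveSpace n k).left, ∃ U : (Literature.AlgebraicGeometry.Motives.projectiveSpace n k).left.affineOpens, y ∈ (U : (Literature.AlgebraicGeometry.Motives.projectiveSpace n k).left.Opens) ∧ (ι.ker.ideal U).IsPrincipal) → PointDropAt p k n H ι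

/-- `PointDrop p ↔ FinishIsolated p`. [folklore] -/
theorem pointDrop_iff_finishIsolated (p : ℕ) : PointDrop p ↔ FinishIsolated p :=
  ⟨fun h hp k _ _ _ n H ι hι hH hloc => finishIsolatedAt_of_pointDropAt p k n H ι (h hp k n H ι hι hH hloc),
    fun h hp k _ _ _ n H ι hι hH hloc => pointDropAt_of_finishIsolatedAt p k n H ι (h hp k n H ι hι hH hloc)⟩

/-- **THE DECOMPOSITION THEOREM — the crux `EquisingularLiftNat` BY NAME from the two pieces** (`(∀ p, ReachIsolated p) → (∀ p, FinishIsolated p) →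
EquisingularLiftNat`; pure logic + `natAt_of_horizAt`; `p` a parameter as in the bands `UpToThree p` of p501020). [folklore] -/
theorem equisingularLiftNat_of_stages (hA : ∀ p : ℕ, ReachIsolated p) (hB : ∀ p : ℕ, FinishIsolated p) :
    Summit.ResolutionOfSingularities.ResolutionOfSingularities.Theses.EquisingularLift.EquisingularLiftNat := by
  intro p hp k _ _ _ n H ι hι hH hloc
  exact natAt_of_horizAt p k n H ι hι hH
    (horizAt_of_reachIsolatedAt_of_finishIsolatedAt p k n H ι (hA p hp k n H ι hι hH hloc) (hB p hp k n H ι hι hH hloc))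

/-- The crux BY NAME with piece B in inductive form. [folklore] -/
theorem equisingularLiftNat_of_reach_pointDrop (hA : ∀ p : ℕ, ReachIsolated p) (hB : ∀ p : ℕ, PointDrop p) :
    Summit.ResolutionOfSingularities.ResolutionOfSingularities.Theses.EquisingularLift.EquisingularLiftNat :=
  equisingularLiftNat_of_stages hA (fun p => (pointDrop_iff_finishIsolated p).1 (hB p))

/-- Hence the summit conclusion for hypersurfaces: **A ∧ B resolve every integral hypersurface of every `ℙⁿ_k̄`**. [folklore] -/
theorem hasResolution_hypersurface_of_stages (hA : ∀ p : ℕ, ReachIsolated p) (hB : ∀ p : ℕ, FinishIsolated p) :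
    ∀ p : ℕ, p.Prime → ∀ (k : Type) [Field k] [CharP k p] [IsAlgClosed k] (n : ℕ) (H : AlgebraicGeometry.Scheme.{0}) (ι : H ⟶ (Literature.AlgebraicGeometry.Motives.projectiveSpace n k).left), AlgebraicGeometry.IsClosedImmersion ι → AlgebraicGeometry.IsIntegral H → (∀ y : (Literature.AlgebraicGeometry.Motives.projectiveSpace n k).left, ∃ U : (Literature.AlgebraicGeometry.Motives.projectiveSpace n k).left.affineOpens, y ∈ (U : (Literature.AlgebraicGeometry.Motives.projectiveSpace n k).left.Opens) ∧ (ι.ker.ideal U).IsPrincipal) → Literature.AlgebraicGeometry.Resolution.Scheme.HasResolution H :=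
  fun p hp k _ _ _ n H ι hι hH hloc =>
    hasResolution_of_reachIsolatedAt_of_finishIsolatedAt p k n H ι hι hH (hA p hp k n H ι hι hH hloc) (hB p hp k n H ι hι hH hloc)

/-! ## The registered residual band `4 ≤ n` (skeleton `sections` v6, stub `stub_elnat_ge_four`) -/

/-- [OURS · L1 W4.5(b)] **Piece A on the residual band**: the hypothesis prefix of `GeFourHoriz` (`4 ≤ n`, `H` not regular), then
`ReachIsolatedAt`. [folklore] -/
def GeFourReachIsolated (p : ℕ) : Prop :=
  p.Prime → ∀ (k : Type) [Field k] [CharP k p] [IsAlgClosed k] (n : ℕ) (H : AlgebraicGeometry.Scheme.{0}) (ι : H ⟶ (Literature.AlgebraicGeometry.Motives.projectiveSpace n k).left), AlgebraicGeometry.IsClosedImmersion ι → AlgebraicGeometry.IsIntegral H → (∀ y : (Literature.AlgebraicGeometry.Motives.projectiveSpace n k).left, ∃ U : (Literature.AlgebraicGeometry.Motives.projectiveSpace n k).left.affineOpens, y ∈ (U : (Literature.AlgebraicGeometry.Motives.projectiveSpace n k).left.Opens) ∧ (ι.ker.ideal U).IsPrincipal) → 4 ≤ n → ¬ Literature.AlgebraicGeometry.Resolution.Scheme.IsRegular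 H → ReachIsolatedAt p k n H ι

/-- [OURS · L1 W4.5(b)] **Piece B on the residual band.** [folklore] -/
def GeFourFinishIsolated (p : ℕ) : Prop :=
  p.Prime → ∀ (k : Type) [Field k] [CharP k p] [IsAlgClosed k] (n : ℕ) (H : AlgebraicGeometry.Scheme.{0}) (ι : H ⟶ (Literature.AlgebraicGeometry.Motives.projectiveSpace n k).left), AlgebraicGeometry.IsClosedImmersion ι → AlgebraicGeometry.IsIntegral H → (∀ y : (Literature.AlgebraicGeometry.Motives.projectiveSpace n k).left, ∃ U : (Literature.AlgebraicGeometry.Motives.projectiveSpace n k).left.affineOpens, y ∈ (U : (Literature.AlgebraicGeometry.Motives.projectiveSpace n k).left.Opens) ∧ (ι.ker.ideal U).IsPrincipal) → 4 ≤ n → ¬ Literature.AlgebraicGeometry.Resolution.Scheme.IsRegular H → FinishIsolatedAt p k n H ι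

/-- [OURS · L1 W4.5(b)] **Piece B in inductive form on the residual band.** [folklore] -/
def GeFourPointDrop (p : ℕ) : Prop :=
  p.Prime → ∀ (k : Type) [Field k] [CharP k p] [IsAlgClosed k] (n : ℕ) (H : AlgebraicGeometry.Scheme.{0}) (ι : H ⟶ (Literature.AlgebraicGeometry.Motives.projectiveSpace n k).left), AlgebraicGeometry.IsClosedImmersion ι → AlgebraicGeometry.IsIntegral H → (∀ y : (Literature.AlgebraicGeometry.Motives.projectiveSpace n k).left, ∃ U : (Literature.AlgebraicGeometry.Motives.projectiveSpace n k).left.affineOpens, y ∈ (U : (Literature.AlgebraicGeometry.Motives.projectiveSpace n k).left.Opens) ∧ (ι.ker.ideal U).IsPrincipal) → 4 ≤ n → ¬ Literature.AlgebraicGeometry.Resolution.Scheme.IsRegular H → PointDropAt p k n H ι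

/-- The horizontal residual `GeFourHoriz p` (p508745) from the two pieces on the band. [folklore] -/
theorem geFourHoriz_of_stages (p : ℕ) (hA : GeFourReachIsolated p) (hB : GeFourFinishIsolated p) : GeFourHoriz p := by
  intro hp k _ _ _ n H ι hι hH hloc hn hHreg
  exact horizAt_of_reachIsolatedAt_of_finishIsolatedAt p k n H ι (hA hp k n H ι hι hH hloc hn hHreg) (hB hp k n H ι hι hH hloc hn hHreg)

/-- The same with B in inductive form. [folklore] -/
theorem geFourHoriz_of_reach_pointDrop (p : ℕ) (hA : GeFourReachIsolated p) (hB : GeFourPointDrop p) : GeFourHoriz p := by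
  intro hp k _ _ _ n H ι hι hH hloc hn hHreg
  exact horizAt_of_reachIsolatedAt_of_pointDropAt p k n H ι (hA hp k n H ι hι hH hloc hn hHreg) (hB hp k n H ι hι hH hloc hn hHreg)

/-- **`stub_elnat_ge_four` (registered v6 text, verbatim) from the two pieces on the band** — so the lead may reshape the residual stub into
`stub_elnat_ge_four_reach : GeFourReachIsolated p` and `stub_elnat_ge_four_finish : GeFourFinishIsolated p` (or `GeFourPointDrop p`) without
touching `EquisingularLiftNat_of` (`stub_elnat_ge_four_of_geFourHoriz`, p508745). [folklore] -/
theorem stub_elnat_ge_four_of_stages (p : ℕ) (hA : GeFourReachIsolated p) (hB : GeFourFinishIsolated p) :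
    p.Prime → ∀ (k : Type) [Field k] [CharP k p] [IsAlgClosed k] (n : ℕ) (H : AlgebraicGeometry.Scheme.{0}) (ι : H ⟶ (Literature.AlgebraicGeometry.Motives.projectiveSpace n k).left), AlgebraicGeometry.IsClosedImmersion ι → AlgebraicGeometry.IsIntegral H → (∀ y : (Literature.AlgebraicGeometry.Motives.projectiveSpace n k).left, ∃ U : (Literature.AlgebraicGeometry.Motives.projectiveSpace n k).left.affineOpens, y ∈ (U : (Literature.AlgebraicGeometry.Motives.projectiveSpace n k).left.Opens) ∧ (ι.ker.ideal U).IsPrincipal) → 4 ≤ n → ∃ (O : Type) (_ : CommRing O) (_ : IsDomain O) (_ : IsDiscreteValuationRing O) (_ : CharZero O) (π : O →+* k), Function.Surjective π ∧ (letI := MvPolynomial.gradedAlgebra (σ := Fin (n + 1)) (R := O); letI := MvPolynomial.gradedAlgebra (σ := Fin (n + 1)) (R := k); ∀ (φ : MvPolynomial.homogeneousSubmodule (Fin (n + 1)) O →+*ᵍ MvPolynomial.homogeneousSubmodule (Fin (n + 1)) k) (hφ' : HomogeneousIdeal.irrelevant (MvPolynomial.homogeneousSubmodule (Fin (n + 1))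 k) ≤ (HomogeneousIdeal.irrelevant (MvPolynomial.homogeneousSubmodule (Fin (n + 1)) O)).map φ), (∀ s, φ s = MvPolynomial.map π s) → ∀ Y : Set (AlgebraicGeometry.Proj (MvPolynomial.homogeneousSubmodule (Fin (n + 1)) O)), Y = Set.range (CategoryTheory.CategoryStruct.comp ι (AlgebraicGeometry.Proj.map φ hφ') : H ⟶ (AlgebraicGeometry.Proj (MvPolynomial.homogeneousSubmodule (Fin (n + 1)) O))) → ∃ (P' : AlgebraicGeometry.Scheme.{0}) (σ : P' ⟶ (AlgebraicGeometry.Proj (MvPolynomial.homogeneousSubmodule (Fin (n + 1)) O))) (S' : Set P'), (∀ Q : (∀ X' : AlgebraicGeometry.Scheme.{0}, (X' ⟶ (AlgebraicGeometry.Proj (MvPolynomial.homogeneousSubmodule (Fin (n + 1)) O))) → Set X' → Prop), Q (AlgebraicGeometry.Proj (MvPolynomial.homogeneousSubmodule (Fin (n + 1)) O)) (CategoryTheory.CategoryStruct.id _) Y → (∀ (X' X'' : AlgebraicGeometry.Scheme.{0}) (σ' : X' ⟶ (AlgebraicGeometry.Proj (MvPolynomial.homogeneousSubmodule (Fin (n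 + 1)) O))) (Y' : Set X') (C : X'.IdealSheafData) (τ : X'' ⟶ X'), Q X' σ' Y' → Literature.AlgebraicGeometry.Resolution.IsBlowup τ C → Literature.AlgebraicGeometry.Resolution.Scheme.IsRegular C.subscheme → σ' '' (C.support : Set X') ⊆ {x | ¬ IsGenericPoint x Y} → (C.support : Set X') ∩ (CategoryTheory.CategoryStruct.comp σ' (CategoryTheory.CategoryStruct.comp (AlgebraicGeometry.Proj.toSpecZero (MvPolynomial.homogeneousSubmodule (Fin (n + 1)) O)) (AlgebraicGeometry.Spec.map (CommRingCat.ofHom (algebraMap O (MvPolynomial.homogeneousSubmodule (Fin (n + 1)) O 0)))))) ⁻¹' {IsLocalRing.closedPoint O} ⊆ Y' → Q X'' (CategoryTheory.CategoryStruct.comp τ σ') (closure (τ ⁻¹' (Y' \ (C.support : Set X'))))) → Q P' σ S') ∧ IsIrreducible ((CategoryTheory.CategoryStruct.comp σ (CategoryTheory.CategoryStruct.comp (AlgebraicGeometry.Proj.toSpecZero (MvPolynomial.homogeneousSubmodule (Fin (n + 1)) O)) (AlgebraicGeometry.Spec.map (CommRingCat.ofHom (algebraMap O (MvPolynomial.homogeneousSubmodule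 (Fin (n + 1)) O 0)))))) ⁻¹' {IsLocalRing.closedPoint O}) ∧ Literature.AlgebraicGeometry.Resolution.Scheme.IsRegular (AlgebraicGeometry.Scheme.IdealSheafData.vanishingIdeal (⟨closure S', isClosed_closure⟩ : TopologicalSpace.Closeds P')).subscheme) :=
  stub_elnat_ge_four_of_geFourHoriz p (geFourHoriz_of_stages p hA hB)

/-- **The crux BY NAME from the band `n ≤ 3` (`UpToThree`, p501020) and the two pieces on the residual band.** [folklore] -/
theorem equisingularLiftNat_of_upToThree_of_stages (h3 : ∀ p : ℕ, UpToThree p) (hA : ∀ p : ℕ, GeFourReachIsolated p)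
    (hB : ∀ p : ℕ, GeFourFinishIsolated p) :
    Summit.ResolutionOfSingularities.ResolutionOfSingularities.Theses.EquisingularLift.EquisingularLiftNat := by
  intro p hp k _ _ _ n H ι hι hH hloc
  rcases Nat.lt_or_ge n 4 with h | h
  · exact h3 p hp k n H ι hι hH hloc (by omega)
  · exact stub_elnat_ge_four_of_stages p (hA p) (hB p) hp k n H ι hι hH hloc h

/-! ## Each piece is implied by the corresponding ∀-piece restricted to the band (bookkeeping for the lead's census) -/

/-- `ReachIsolated` restricted to the band `4 ≤ n`. [folklore] -/
theorem geFourReachIsolated_of_reachIsolated (p : ℕ) (h : ReachIsolated p) : GeFourReachIsolated p :=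
  fun hp k _ _ _ n H ι hι hH hloc _ _ => h hp k n H ι hι hH hloc

/-- `FinishIsolated` restricted to the band `4 ≤ n`. [folklore] -/
theorem geFourFinishIsolated_of_finishIsolated (p : ℕ) (h : FinishIsolated p) : GeFourFinishIsolated p :=
  fun hp k _ _ _ n H ι hι hH hloc _ _ => h hp k n H ι hι hH hloc

end Summit.ResolutionOfSingularities.ResolutionOfSingularities.Theorems.EquisingularLiftNatStageCut
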